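import Summits.AtomisticToContinuum.HydrodynamicLimit.Theorems.EquilibriumFastWindowLD.Negative.ConservedWindowSums

/-!
# `EquilibriumFastWindowLD` — negative knowledge (a.3): orthogonality to the ENERGY `|v|²` is load-bearing

Support file for crux `stmt-AtomisticToContinuum-14440` (`TwoClocks.EquilibriumFastWindowLD`), written by
the standing disprover (cdisprove seat). `EquilibriumFastWindowLDWithoutOrthEnergy` is the crux with the
single clause `∀ x, ∫ F(x,v) |v|² M_{1,u₀,θ₀}(v) dv = 0` DELETED (all other tokens verbatim; it trivially
implies the crux) and it is FALSE, unconditionally: with `a₀ = θ₀ = 1`, `u₀ = 0`, any small `σ`, the tree's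
Alexander flows and the witness `F(x,v) = ‖v‖² − 3` (continuous, quadratic growth, `⊥ 1` and `⊥ v_j` under
`M_{1,0,1}` — but `∫ F|v|²M = 15 − 9 = 6 ≠ 0`), the window sum `Σᵢ w⁻¹∫₀ʷ F(vᵢ(r)) dr = 2E(z) − 3(N+1)` is
CONSERVED along every hard-sphere flow (`windowSum_affine_normSq_eq`), so for every window the moment is the
static value `(e^{-3β}(1-2β)^{-3/2})^{N+1} = e^{2ε(N+1)}` with `ε := ½(−3β − (3/2)log(1−2β)) > 0`
(`log(1−2β) < −2β`), twice the allowed exponent: the conclusion fails at `β = min β₀ ¼`, this `ε`, every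
`τ`, at `N = N₀`. Physically: the energy shell is an exactly invariant structure; a tilt of the temperature
is never relaxed by the deterministic dynamics, and only `F ⊥ |v|²` makes its first-order gain vanish.
-/

noncomputable section

open MeasureTheory ProbabilityTheory Real Set
open scoped ENNReal

namespace Summit.AtomisticToContinuum.HydrodynamicLimit.Theorems.EquilibriumFastWindowLDNegative

open Literature.Analysis.FluidPDE Literature.MathematicalPhysics.KineticTheory
open Summit.AtomisticToContinuum.HydrodynamicLimit.Theorems.CorrectorPressureDecayNegative

/-- `TwoClocks.EquilibriumFastWindowLD` with the clause `F ⊥ |v|²` (`∀ x, ∫ F(x,v)‖v‖² M = 0`) DELETED;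
all other tokens verbatim. A variant statement refuted below, not a fact. -/
def EquilibriumFastWindowLDWithoutOrthEnergy : Prop :=
  ∃ σ₀ : ℝ, 0 < σ₀ ∧ ∀ (a₀ θ₀ : ℝ) (u₀ : V3), 0 < a₀ → 0 < θ₀ → ∀ σ : ℝ, 0 < σ → σ < σ₀ →
    ∀ Φ : (N : ℕ) → HardSphereFlow (Torus.geometry (Fin 3)) (hsDiameter σ N) (N + 1),
    ∀ F : T3 × V3 → ℝ, Continuous F → (∃ C : ℝ, ∀ y, |F y| ≤ C * (1 + ‖y.2‖ ^ 2)) →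
    (∀ x, ∫ v, F (x, v) * localMaxwellian 1 θ₀ u₀ v = 0) →
    (∀ x (j : Fin 3), ∫ v, F (x, v) * v j * localMaxwellian 1 θ₀ u₀ v = 0) →
    ∃ β₀ : ℝ, 0 < β₀ ∧ ∀ β : ℝ, |β| ≤ β₀ → ∀ ε : ℝ, 0 < ε → ∃ τ : ℝ, 0 < τ ∧ ∃ N₀ : ℕ,
      ∀ N : ℕ, N₀ ≤ N →
        ∫⁻ z, ENNReal.ofReal (Real.exp (β * ∑ i : Fin (N + 1),
            (τ * ((N : ℝ) + 1) ^ (-(1 / 3 : ℝ)))⁻¹ *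
              ∫ r in (0 : ℝ)..(τ * ((N : ℝ) + 1) ^ (-(1 / 3 : ℝ))), F (((Φ N).flow r z) i)))
          ∂(localGibbsLaw σ (fun _ => a₀) (fun _ => u₀) (fun _ => θ₀) N (Φ N)) ≤
        ENNReal.ofReal (Real.exp (ε * ((N : ℝ) + 1)))

/-- **The per-particle factor of an affine energy observable is an exact exponential**: for `0 < 1 - 2c`,
`e^{x} ((1-2c)^{-1/2})³ = exp(x − (3/2) log(1−2c))`. [folklore] -/
theorem exp_mul_rpow_cube_eq_exp (x : ℝ) {c : ℝ} (hc : 0 < 1 - 2 * c) :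
    Real.exp x * ((1 - 2 * c) ^ (-(1 / 2 : ℝ))) ^ 3 = Real.exp (x - 3 / 2 * Real.log (1 - 2 * c)) := by
  rw [Real.rpow_def_of_pos hc, ← Real.exp_nat_mul, ← Real.exp_add]
  congr 1
  push_cast
  ring

/-- **An exact exponential moment twice too large contradicts the conclusion**: if `ε > 0` and the
window moment equals `(e^{2ε})^{N+1}` in the form produced by `windowMoment_affine_normSq_eq`, it is not
`≤ exp(ε(N+1))`. [folklore] -/
theorem not_le_of_moment_eq {M : ℝ≥0∞} {x c ε : ℝ} (hc : 0 < 1 - 2 * c) (hε : 0 < ε)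
    (h2ε : x - 3 / 2 * Real.log (1 - 2 * c) = 2 * ε) (N : ℕ)
    (hM : M = (ENNReal.ofReal (Real.exp x) * ENNReal.ofReal ((1 - 2 * c) ^ (-(1 / 2 : ℝ))) ^ 3) ^ (N + 1)) :
    ¬ M ≤ ENNReal.ofReal (Real.exp (ε * ((N : ℝ) + 1))) := by
  have hr : 0 ≤ (1 - 2 * c) ^ (-(1 / 2 : ℝ)) := Real.rpow_nonneg hc.le _
  rw [hM, ← ENNReal.ofReal_pow hr, ← ENNReal.ofReal_mul (Real.exp_pos _).le,
    exp_mul_rpow_cube_eq_exp x hc, h2ε, ← ENNReal.ofReal_pow (Real.exp_pos _).le, ← Real.exp_nat_mul,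
    ENNReal.ofReal_le_ofReal_iff (Real.exp_pos _).le, Real.exp_le_exp, not_le]
  push_cast
  nlinarith

/-- **(a.3) Orthogonality to `|v|²` is load-bearing.** [folklore] -/
theorem equilibriumFastWindowLD_false_without_orthEnergy : ¬ EquilibriumFastWindowLDWithoutOrthEnergy := by
  rintro ⟨σ₀, hσ₀, h⟩
  -- a reduced density in range and the Alexander flows
  set σ : ℝ := min (σ₀ / 2) (1 / 4) with hσdef
  have hσpos : 0 < σ := lt_min (by linarith) (by norm_num)
  have hσlt : σ < σ₀ := (min_le_left _ _).trans_lt (by linarith)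
  have hσ2 : σ ≤ 1 / 2 := (min_le_right _ _).trans (by norm_num)
  have hσhalf : σ < 2⁻¹ := (min_le_right _ _).trans_lt (by norm_num)
  set Φ : (N : ℕ) → HardSphereFlow (Torus.geometry (Fin 3)) (hsDiameter σ N) (N + 1) :=
    fun N => Classical.choice (nonempty_flow hσpos hσhalf N) with hΦdef
  -- the witness `F(x,v) = -3 + 1·‖v‖²`
  set F : T3 × V3 → ℝ := fun y => -3 + 1 * ‖y.2‖ ^ 2 with hFdef
  have hFc : Continuous F := by rw [hFdef]; fun_prop
  have hFg : ∃ C : ℝ, ∀ y, |F y| ≤ C * (1 + ‖y.2‖ ^ 2) := by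
    refine ⟨3, fun y => ?_⟩
    rw [hFdef]
    have h0 : 0 ≤ ‖y.2‖ ^ 2 := sq_nonneg _
    rw [abs_le]
    constructor <;> nlinarith
  have hF1 : ∀ x : T3, ∫ v, F (x, v) * localMaxwellian 1 1 (0 : V3) v = 0 := by
    intro x
    simp only [hFdef]
    rw [integral_affine_normSq_mul_localMaxwellian (-3) 1]
    norm_num
  have hFv : ∀ (x : T3) (j : Fin 3), ∫ v, F (x, v) * v j * localMaxwellian 1 1 (0 : V3) v = 0 := by
    intro x j
    simp only [hFdef]
    exact integral_radial_mul_coord_mul_localMaxwellian (fun s => -3 + 1 * s) 1 j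
  obtain ⟨β₀, hβ₀, hβ⟩ := h 1 1 0 one_pos one_pos σ hσpos hσlt Φ F hFc hFg hF1 hFv
  -- a tilt in range and the doubled exponent
  set β : ℝ := min β₀ (1 / 4) with hβdef
  have hβpos : 0 < β := lt_min hβ₀ (by norm_num)
  have hβle : |β| ≤ β₀ := by rw [abs_of_pos hβpos]; exact min_le_left _ _
  have hβ4 : β ≤ 1 / 4 := min_le_right _ _
  have hc : 0 < 1 - 2 * (β * 1) := by linarith
  set ε : ℝ := (β * (-3) - 3 / 2 * Real.log (1 - 2 * (β * 1))) / 2 with hεdef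
  have hlog : Real.log (1 - 2 * (β * 1)) < -2 * β := by
    have h := Real.log_lt_sub_one_of_pos hc (by linarith)
    linarith
  have hε : 0 < ε := by rw [hεdef]; linarith
  obtain ⟨τ, hτ, N₀, hN⟩ := hβ β hβle ε hε
  have hw : 0 < τ * ((N₀ : ℝ) + 1) ^ (-(1 / 3 : ℝ)) := mul_pos hτ (Real.rpow_pos_of_pos (by positivity) _)
  have hval := windowMoment_affine_normSq_eq one_pos hσ2 N₀ (Φ N₀) (-3) 1 (β := β) (by linarith) hw
  exact not_le_of_moment_eq hc hε (by rw [hεdef]; ring) N₀ hval (hN N₀ le_rfl)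

end Summit.AtomisticToContinuum.HydrodynamicLimit.Theorems.EquilibriumFastWindowLDNegative

end
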